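import Mathlib
import Summits.Ventures.HodgeRepro2.Tier7.Line3.DiscreteUnitaryFactor

/-!
# Tier 7 — LINE 3 support: the cover lift — `1` isolated lifts to the full preimage, and the lifted Poincaré series is
`|Z|` times the real one (`Line3/DiscreteCoverLift.lean`; t7-L1-p1, gen 4; Mathlib + Line3/DiscreteUnitaryFactor)

`DiscreteCompactFactor` / `DiscreteUnitaryFactor` count a subgroup `Γ̃ ≤ K × SL(2,ℝ)²` with `1` isolated and prove that its
Poincaré series converges absolutely and is continuous. The real lattice `Γ_N` of the line lives in `U(2) × U(1,1)²`, and
the kernel rows are applied to its FULL PREIMAGE `Γ̃ = p⁻¹(Γ_N)` under the cover `p : (U(2) × U(1)²) × SU(1,1)² → U(2) × U(1,1)²`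
(kernel `Z = {±1}²`, `|Z| = 4`; `SU(1,1) ≅ SL(2,ℝ)` by `cay`). Two facts about that passage were left «in words» by the
critics' records (crit-2 ll. 15414 (a)/(b) and 15438 (a)–(d)); THIS FILE states and proves them abstractly:
* **the cover lift** (record (c)): `1` isolated in `Γ ≤ H` lifts through ANY continuous homomorphism `p : H' →* H` whose
  kernel has `1` isolated — in particular through one with FINITE kernel in a `T1` group — to `Γ.comap p` (`isolatedOne_comap`,
  `isolatedOne_comap_of_finite_ker`); continuity of `p` at `1` and the isolated kernel suffice, no local homeomorphism is
  needed. On `K × SL(2,ℝ)²` the notion is `DiscreteCompactFactor.IsolatedOneTop` (`isolatedOneTop_comap`), so the counts and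
  the kernel continuity of `DiscreteUnitaryFactor` apply to the lifted lattice (`count_K₃_comap`, `continuous_kernelSum_K₃_comap_three`);
* **the two kernels** (records (a)/(b)): for a surjective homomorphism `q : Γ' →* Γ` with finite kernel every fibre is a coset of
  the kernel (`fibreEquivKer`, `card_fibre`), so a summable pull-back sums to `|ker q|` times the sum on `Γ`
  (`tsum_comp_eq_card_mul_tsum`, `summable_of_summable_comp`); hence the Poincaré kernel of the lifted lattice for the
  pulled-back test function `f ∘ p` at lifted points is `|ker p|` times the kernel of `Γ` for `f` at the images
  (`kernelSum_comap_eq`: «Γ̃-sum = 4 × Γ_N-sum»), and the real kernel's absolute convergence follows from the lifted one's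
  (`summable_kernel_of_comap`). By contrast a function which transforms under a NON-TRIVIAL character of the kernel sums to
  zero over the preimage (`sum_eq_zero_of_ne_one`, `tsum_eq_zero_of_equivariant`) — the odd-weight cancellation of record (b):
  the value of the real kernel is the sum of the PULL-BACK `f ∘ p` (invariant under `Z`), never of a product `f₂ ⊗ f₃` alone;
* record (d): the bound `h₁` on the compact factor `K₃ = U(2) × U(1)²` is discharged by compactness
  (`exists_bound_of_continuous_K₃`).
* (v2, §6, append-only) when the cover is moreover OPEN, `p × p` is a quotient map and the REAL kernel is continuous on
  `H × H` (`continuous_kernelSum_of_comap`; on `K₃` with the factored pull-back `f ∘ p = f₁ ⊗ f₂ ⊗ f₃`: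
  `continuous_kernelSum_K₃_of_comap_three`) — openness of the named cover stays in words (a local homeomorphism / the open
  mapping theorem for the 2-to-1 covers).
Everything is stated for abstract groups: which lattice is `Γ_N`, which cover is `p`, which function is `f` stay the dictionary
(TYPING-CENSUS T7); nothing about (N) or (P). Sorry-free; axioms: propext / Classical.choice / Quot.sound.
§8(d): uses an L-value-free non-vanishing device: NO.
-/

namespace Summit.Ventures.HodgeRepro2.Tier7.Line3.DiscreteCoverLift

open Summit.Ventures.HodgeRepro2.Tier7.Line3.DiscreteCompactFactor
  Summit.Ventures.HodgeRepro2.Tier7.Line3.DiscreteUnitaryFactor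
  Summit.Ventures.HodgeRepro2.Tier7.Line3.DiscreteProductCount
  Summit.Ventures.HodgeRepro2.Tier7.Line3.HyperbolicSize
open scoped MatrixGroups

noncomputable section

/-! ## 1. `1` isolated in a subgroup of a topological group; finite subgroups; the cover lift -/

section Isolated

variable {H : Type*} [TopologicalSpace H] [Group H]

/-- `1` is isolated in the subgroup `Γ` of the topological group `H`: some neighbourhood of `1` meets `Γ` only in `1` -/
def IsolatedOne (Γ : Subgroup H) : Prop := ∃ V ∈ nhds (1 : H), ∀ γ ∈ Γ, γ ∈ V → γ = 1

/-- a finite subgroup of a `T1` group has `1` isolated (the complement of the finite set `Z ∖ {1}` is an open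
neighbourhood of `1`) -/
theorem isolatedOne_of_finite [T1Space H] (Z : Subgroup H) (hZ : (Z : Set H).Finite) : IsolatedOne Z := by
  classical
  refine ⟨((hZ.toFinset.erase 1 : Finset H) : Set H)ᶜ, ?_, ?_⟩
  · apply IsOpen.mem_nhds (Finset.isClosed _).isOpen_compl
    simp
  · intro γ hγ hγV
    by_contra hne
    apply hγV
    simp only [Finset.coe_erase, Set.Finite.coe_toFinset, Set.mem_sdiff, SetLike.mem_coe, Set.mem_singleton_iff]
    exact ⟨hγ, hne⟩

/-- **COVER LIFT**: `1` isolated in `Γ ≤ H` lifts through any continuous homomorphism `p : H' →* H` whose kernel has `1`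
isolated to the full preimage `Γ.comap p` — continuity at `1` and the isolated kernel suffice -/
theorem isolatedOne_comap {H' : Type*} [TopologicalSpace H'] [Group H'] (p : H' →* H) (hp : Continuous p)
    (hker : IsolatedOne p.ker) {Γ : Subgroup H} (hΓ : IsolatedOne Γ) : IsolatedOne (Γ.comap p) := by
  obtain ⟨V₁, hV₁, hV₁ker⟩ := hker
  obtain ⟨U, hU, hUΓ⟩ := hΓ
  have hpU : p ⁻¹' U ∈ nhds (1 : H') := hp.continuousAt.preimage_mem_nhds (by rw [map_one]; exact hU)
  refine ⟨V₁ ∩ p ⁻¹' U, Filter.inter_mem hV₁ hpU, ?_⟩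
  intro γ hγ hγV
  have h1 : p γ = 1 := hUΓ (p γ) (Subgroup.mem_comap.mp hγ) hγV.2
  exact hV₁ker γ (MonoidHom.mem_ker.mpr h1) hγV.1

/-- the cover lift through a continuous homomorphism with FINITE kernel (a `T1` source) -/
theorem isolatedOne_comap_of_finite_ker {H' : Type*} [TopologicalSpace H'] [Group H'] [T1Space H'] (p : H' →* H)
    (hp : Continuous p) (hker : (p.ker : Set H').Finite) {Γ : Subgroup H} (hΓ : IsolatedOne Γ) :
    IsolatedOne (Γ.comap p) :=
  isolatedOne_comap p hp (isolatedOne_of_finite _ hker) hΓ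

end Isolated

section CompactFactor

variable {K : Type} [TopologicalSpace K] [Group K]

/-- on `K × SL(2,ℝ)²` the notion is `DiscreteCompactFactor.IsolatedOneTop` -/
theorem isolatedOne_iff_isolatedOneTop (Γ : Subgroup (K × G₂)) : IsolatedOne Γ ↔ IsolatedOneTop Γ := Iff.rfl

/-- the lift of `1`-isolation to a subgroup of `K × SL(2,ℝ)²` through a cover `p : K × SL(2,ℝ)² →* H` with isolated kernel -/
theorem isolatedOneTop_comap {H : Type*} [TopologicalSpace H] [Group H] (p : (K × G₂) →* H) (hp : Continuous p)
    (hker : IsolatedOne p.ker) {Γ : Subgroup H} (hΓ : IsolatedOne Γ) : IsolatedOneTop (Γ.comap p) :=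
  isolatedOne_comap p hp hker hΓ

/-- the same with a finite kernel (`K` a `T1` space) -/
theorem isolatedOneTop_comap_of_finite_ker [T1Space K] {H : Type*} [TopologicalSpace H] [Group H] (p : (K × G₂) →* H)
    (hp : Continuous p) (hker : (p.ker : Set (K × G₂)).Finite) {Γ : Subgroup H} (hΓ : IsolatedOne Γ) :
    IsolatedOneTop (Γ.comap p) :=
  isolatedOne_comap_of_finite_ker p hp hker hΓ

end CompactFactor

/-! ## 2. Sums over the preimage: fibres are cosets of the kernel -/

section Fibres

variable {Γ' Γ : Type*} [Group Γ'] [Group Γ] (q : Γ' →* Γ)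

/-- the fibre of `q` over `q γ₀` is in bijection with the kernel, `γ ↦ γ₀⁻¹ γ` -/
def fibreEquivKer (γ₀ : Γ') : {γ : Γ' // q γ = q γ₀} ≃ q.ker where
  toFun γ := ⟨γ₀⁻¹ * γ.1, by rw [MonoidHom.mem_ker, map_mul, map_inv, γ.2, inv_mul_cancel]⟩
  invFun z := ⟨γ₀ * z.1, by rw [map_mul, MonoidHom.mem_ker.mp z.2, mul_one]⟩
  left_inv γ := by ext; simp
  right_inv z := by ext; simp

/-- every fibre over the image has the cardinality of the kernel -/
theorem card_fibre (γ₀ : Γ') : Nat.card {γ : Γ' // q γ = q γ₀} = Nat.card q.ker :=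
  Nat.card_congr (fibreEquivKer q γ₀)

/-- the fibres are finite when the kernel is -/
theorem finite_fibre [Finite q.ker] (γ₀ : Γ') : Finite {γ : Γ' // q γ = q γ₀} :=
  Finite.of_equiv _ (fibreEquivKer q γ₀).symm

/-- **THE TWO KERNELS**: for `q : Γ' →* Γ` surjective with finite kernel and a summable pull-back `F ∘ q`,
`Σ_{γ' ∈ Γ'} F (q γ') = |ker q| · Σ_{γ ∈ Γ} F γ` -/
theorem tsum_comp_eq_card_mul_tsum (hq : Function.Surjective q) [Finite q.ker] (F : Γ → ℂ)
    (hF : Summable fun γ' => F (q γ')) :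
    ∑' γ' : Γ', F (q γ') = (Nat.card q.ker : ℂ) * ∑' γ : Γ, F γ := by
  rw [← (Equiv.sigmaFiberEquiv q).tsum_eq (fun γ' => F (q γ'))]
  have hsum : Summable (fun x : Σ γ : Γ, {γ' : Γ' // q γ' = γ} => F (q (Equiv.sigmaFiberEquiv q x))) :=
    (Equiv.summable_iff _).mpr hF
  rw [hsum.tsum_sigma, ← tsum_mul_left]
  congr 1
  ext γ
  obtain ⟨γ₀, rfl⟩ := hq γ
  haveI := finite_fibre q γ₀
  calc ∑' c : {γ' : Γ' // q γ' = q γ₀}, F (q (Equiv.sigmaFiberEquiv q ⟨q γ₀, c⟩))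
      = ∑' _ : {γ' : Γ' // q γ' = q γ₀}, F (q γ₀) := by
        congr 1
        ext c
        exact congrArg F c.2
    _ = (Nat.card {γ' : Γ' // q γ' = q γ₀} : ℂ) * F (q γ₀) := by rw [tsum_const, nsmul_eq_mul]
    _ = (Nat.card q.ker : ℂ) * F (q γ₀) := by rw [card_fibre]

/-- summability descends: if `F ∘ q` is summable on `Γ'` then `F` is summable on `Γ` -/
theorem summable_of_summable_comp (hq : Function.Surjective q) [Finite q.ker] (F : Γ → ℂ)
    (hF : Summable fun γ' => F (q γ')) : Summable F := by
  have hsum : Summable (fun x : Σ γ : Γ, {γ' : Γ' // q γ' = γ} => F (q (Equiv.sigmaFiberEquiv q x))) :=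
    (Equiv.summable_iff _).mpr hF
  have h1 := hsum.sigma
  have h2 : (fun γ : Γ => ∑' c : {γ' : Γ' // q γ' = γ}, F (q (Equiv.sigmaFiberEquiv q ⟨γ, c⟩)))
      = fun γ => (Nat.card q.ker : ℂ) * F γ := by
    ext γ
    obtain ⟨γ₀, rfl⟩ := hq γ
    haveI := finite_fibre q γ₀
    calc ∑' c : {γ' : Γ' // q γ' = q γ₀}, F (q (Equiv.sigmaFiberEquiv q ⟨q γ₀, c⟩))
        = ∑' _ : {γ' : Γ' // q γ' = q γ₀}, F (q γ₀) := by
          congr 1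
          ext c
          exact congrArg F c.2
      _ = (Nat.card {γ' : Γ' // q γ' = q γ₀} : ℂ) * F (q γ₀) := by rw [tsum_const, nsmul_eq_mul]
      _ = (Nat.card q.ker : ℂ) * F (q γ₀) := by rw [card_fibre]
  rw [h2] at h1
  have hcard : (Nat.card q.ker : ℂ) ≠ 0 := by
    have : 0 < Nat.card q.ker := Nat.card_pos
    exact_mod_cast this.ne'
  have h3 := h1.mul_left ((Nat.card q.ker : ℂ)⁻¹)
  refine h3.congr fun γ => ?_
  rw [← mul_assoc, inv_mul_cancel₀ hcard, one_mul]

/-- a non-trivial (multiplicative) character of a finite group sums to zero -/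
theorem sum_eq_zero_of_ne_one {Z : Type*} [Group Z] [Fintype Z] (ω : Z →* ℂ) (hω : ∃ z, ω z ≠ 1) :
    ∑ z, ω z = 0 := by
  obtain ⟨z₀, hz₀⟩ := hω
  have h : ∑ z, ω z = ω z₀ * ∑ z, ω z := by
    rw [Finset.mul_sum]
    exact (Fintype.sum_equiv (Equiv.mulLeft z₀) (fun z => ω z₀ * ω z) ω (fun z => by simp [map_mul])).symm
  have h0 : (1 - ω z₀) * ∑ z, ω z = 0 := by rw [sub_mul, one_mul, ← h, sub_self]
  rcases mul_eq_zero.mp h0 with h1 | h1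
  · exact absurd (sub_eq_zero.mp h1).symm hz₀
  · exact h1

/-- **THE ODD-WEIGHT CANCELLATION**: a summable function on `Γ'` transforming under a NON-TRIVIAL character `ω` of the
(finite) kernel of a surjective `q : Γ' →* Γ`, `F (γ' z) = ω z · F γ'`, sums to zero over `Γ'` -/
theorem tsum_eq_zero_of_equivariant (hq : Function.Surjective q) [Fintype q.ker] (F : Γ' → ℂ) (hF : Summable F)
    (ω : q.ker →* ℂ) (hω : ∃ z, ω z ≠ 1) (hequiv : ∀ (γ' : Γ') (z : q.ker), F (γ' * z) = ω z * F γ') :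
    ∑' γ', F γ' = 0 := by
  rw [← (Equiv.sigmaFiberEquiv q).tsum_eq F]
  have hsum : Summable (fun x : Σ γ : Γ, {γ' : Γ' // q γ' = γ} => F (Equiv.sigmaFiberEquiv q x)) :=
    (Equiv.summable_iff _).mpr hF
  rw [hsum.tsum_sigma]
  have h2 : (fun γ : Γ => ∑' c : {γ' : Γ' // q γ' = γ}, F (Equiv.sigmaFiberEquiv q ⟨γ, c⟩)) = fun _ => 0 := by
    ext γ
    obtain ⟨γ₀, rfl⟩ := hq γ
    rw [← (fibreEquivKer q γ₀).symm.tsum_eq, tsum_fintype]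
    calc ∑ z : q.ker, F (Equiv.sigmaFiberEquiv q ⟨q γ₀, (fibreEquivKer q γ₀).symm z⟩)
        = ∑ z : q.ker, ω z * F γ₀ := Finset.sum_congr rfl fun z _ => hequiv γ₀ z
      _ = (∑ z : q.ker, ω z) * F γ₀ := by rw [Finset.sum_mul]
      _ = 0 := by rw [sum_eq_zero_of_ne_one ω hω, zero_mul]
  rw [h2, tsum_zero]

end Fibres

/-! ## 3. The restriction of a cover to the preimage of a subgroup -/

section Restrict

variable {H' H : Type*} [Group H'] [Group H] (p : H' →* H) (Γ : Subgroup H)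

/-- the restriction `q : Γ.comap p →* Γ` of `p` to the full preimage of `Γ` -/
def restrictComap : (Γ.comap p) →* Γ :=
  (p.restrict (Γ.comap p)).codRestrict Γ fun γ => γ.2

/-- `q γ = p γ` as elements of `H` -/
@[simp] theorem restrictComap_apply (γ : Γ.comap p) : (restrictComap p Γ γ : H) = p γ := rfl

/-- `q` is surjective when `p` is -/
theorem restrictComap_surjective (hp : Function.Surjective p) : Function.Surjective (restrictComap p Γ) := by
  intro γ
  obtain ⟨g, hg⟩ := hp γ
  exact ⟨⟨g, Subgroup.mem_comap.mpr (hg ▸ γ.2)⟩, Subtype.ext hg⟩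

/-- the kernel of `q` is the kernel of `p` -/
def kerRestrictComapEquiv : (restrictComap p Γ).ker ≃ p.ker where
  toFun z := ⟨z.1.1, by
    have h := MonoidHom.mem_ker.mp z.2
    rw [MonoidHom.mem_ker, ← restrictComap_apply p Γ, h, Subgroup.coe_one]⟩
  invFun k := ⟨⟨k.1, Subgroup.mem_comap.mpr (by rw [MonoidHom.mem_ker.mp k.2]; exact Γ.one_mem)⟩, by
    rw [MonoidHom.mem_ker]
    exact Subtype.ext (by rw [restrictComap_apply]; exact MonoidHom.mem_ker.mp k.2)⟩
  left_inv z := by ext; rfl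
  right_inv k := by ext; rfl

/-- `|ker q| = |ker p|` -/
theorem card_ker_restrictComap : Nat.card (restrictComap p Γ).ker = Nat.card p.ker :=
  Nat.card_congr (kerRestrictComapEquiv p Γ)

/-- `ker q` is finite when `ker p` is -/
theorem finite_ker_restrictComap [Finite p.ker] : Finite (restrictComap p Γ).ker :=
  Finite.of_equiv _ (kerRestrictComapEquiv p Γ).symm

end Restrict

/-! ## 4. The Poincaré kernel of the lifted lattice is `|ker p|` times the real one -/

section Kernel

variable {K : Type} [TopologicalSpace K] [Group K] [IsTopologicalGroup K] [T2Space K] [CompactSpace K]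
  {H : Type} [TopologicalSpace H] [Group H]

/-- **THE LIFTED KERNEL**: for a cover `p : K × SL(2,ℝ)² →* H` (continuous, surjective, finite kernel), a subgroup `Γ ≤ H`
with `1` isolated, and a test function `f` on `H` whose pull-back has the decay `(1 + psize g.2)^(−α)`, `α > 1`, the
Poincaré kernel of `Γ̃ = p⁻¹(Γ)` for `f ∘ p` at `(x̃, ỹ)` equals `|ker p|` times the Poincaré kernel of `Γ` for `f` at
`(p x̃, p ỹ)` — «Γ̃-sum = 4 × Γ_N-sum» -/
theorem kernelSum_comap_eq [T1Space K] (p : (K × G₂) →* H) (hp : Continuous p) (hsurj : Function.Surjective p)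
    (hker : (p.ker : Set (K × G₂)).Finite) {Γ : Subgroup H} (hΓ : IsolatedOne Γ) (f : H → ℂ) {α C : ℝ}
    (hα : 1 < α) (hf : ∀ g, ‖f (p g)‖ ≤ C * (1 + psize g.2) ^ (-α)) (x y : K × G₂) :
    PoincareKernel.kernelSum (fun γ : Γ.comap p => (γ : K × G₂)) (fun g => f (p g)) x y
      = (Nat.card p.ker : ℂ) * PoincareKernel.kernelSum (fun γ : Γ => (γ : H)) f (p x) (p y) := by
  haveI : Finite p.ker := hker.to_subtype
  haveI := finite_ker_restrictComap p Γ
  have hiso : IsolatedOneTop (Γ.comap p) := isolatedOneTop_comap_of_finite_ker p hp hker hΓ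
  have hsumm : Summable fun γ : Γ.comap p => f (p (x⁻¹ * (γ : K × G₂) * y)) :=
    (summable_norm_kernel_compact_product (fun g => f (p g)) (Γ.comap p) hiso hα hf x y).of_norm
  have hsumm' : Summable fun γ : Γ.comap p => f ((p x)⁻¹ * (restrictComap p Γ γ : H) * p y) := by
    refine hsumm.congr fun γ => ?_
    simp only [restrictComap_apply, map_mul, map_inv]
  unfold PoincareKernel.kernelSum
  calc ∑' γ : Γ.comap p, f (p (x⁻¹ * (γ : K × G₂) * y))
      = ∑' γ : Γ.comap p, f ((p x)⁻¹ * (restrictComap p Γ γ : H) * p y) := by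
        congr 1
        ext γ
        simp only [restrictComap_apply, map_mul, map_inv]
    _ = (Nat.card (restrictComap p Γ).ker : ℂ) * ∑' γ : Γ, f ((p x)⁻¹ * (γ : H) * p y) :=
        tsum_comp_eq_card_mul_tsum (restrictComap p Γ) (restrictComap_surjective p Γ hsurj)
          (fun γ : Γ => f ((p x)⁻¹ * (γ : H) * p y)) hsumm'
    _ = (Nat.card p.ker : ℂ) * ∑' γ : Γ, f ((p x)⁻¹ * (γ : H) * p y) := by rw [card_ker_restrictComap]

/-- the real kernel converges absolutely at the image points (the lifted majorant passes to the quotient) -/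
theorem summable_kernel_of_comap [T1Space K] (p : (K × G₂) →* H) (hp : Continuous p) (hsurj : Function.Surjective p)
    (hker : (p.ker : Set (K × G₂)).Finite) {Γ : Subgroup H} (hΓ : IsolatedOne Γ) (f : H → ℂ) {α C : ℝ}
    (hα : 1 < α) (hf : ∀ g, ‖f (p g)‖ ≤ C * (1 + psize g.2) ^ (-α)) (x y : K × G₂) :
    Summable fun γ : Γ => f ((p x)⁻¹ * (γ : H) * p y) := by
  haveI : Finite p.ker := hker.to_subtype
  haveI := finite_ker_restrictComap p Γ
  have hiso : IsolatedOneTop (Γ.comap p) := isolatedOneTop_comap_of_finite_ker p hp hker hΓ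
  have hsumm : Summable fun γ : Γ.comap p => f (p (x⁻¹ * (γ : K × G₂) * y)) :=
    (summable_norm_kernel_compact_product (fun g => f (p g)) (Γ.comap p) hiso hα hf x y).of_norm
  have hsumm' : Summable fun γ : Γ.comap p => f ((p x)⁻¹ * (restrictComap p Γ γ : H) * p y) := by
    refine hsumm.congr fun γ => ?_
    simp only [restrictComap_apply, map_mul, map_inv]
  exact summable_of_summable_comp (restrictComap p Γ) (restrictComap_surjective p Γ hsurj) _ hsumm'

end Kernel

/-! ## 5. The compact factor `K₃ = U(2) × U(1)²`: the lifted lattice's count and kernel, the bound by compactness -/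

section K₃

/-- record (d): a continuous function on the compact `K₃ = U(2) × U(1) × U(1)` is bounded -/
theorem exists_bound_of_continuous_K₃ {f₁ : K₃ → ℂ} (hc₁ : Continuous f₁) : ∃ C₁ : ℝ, ∀ k, ‖f₁ k‖ ≤ C₁ := by
  haveI := compactSpace_K₃
  obtain ⟨C₁, hC₁⟩ := (isCompact_range hc₁.norm).bddAbove
  exact ⟨C₁, fun k => hC₁ (Set.mem_range_self k)⟩

variable {H : Type} [TopologicalSpace H] [Group H]

/-- the count of the lifted lattice `p⁻¹(Γ) ≤ (U(2) × U(1)²) × SL(2,ℝ)²` in the product size, `β = 1 + ε'` -/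
theorem count_K₃_comap (p : (K₃ × G₂) →* H) (hp : Continuous p) (hker : (p.ker : Set (K₃ × G₂)).Finite)
    {Γ : Subgroup H} (hΓ : IsolatedOne Γ) {ε' : ℝ} (hε' : 0 < ε') :
    ∃ C' : ℝ, ∀ R : ℝ, 0 ≤ R → ∃ t : Finset (Γ.comap p),
      (∀ γ : Γ.comap p, psize (γ : K₃ × G₂).2 ≤ R → γ ∈ t) ∧ (t.card : ℝ) ≤ C' * (1 + R) ^ (1 + ε') :=
  count_K₃_product (Γ.comap p) (isolatedOneTop_comap_of_finite_ker p hp hker hΓ) hε'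

/-- **THE LINE'S ARCHIMEDEAN KERNEL ON THE LIFTED LATTICE**: for `Γ ≤ H` with `1` isolated, a cover
`p : (U(2) × U(1)²) × SL(2,ℝ)² →* H` with finite kernel, `f₁` continuous on the compact factor (no bound assumed) and
`f₂, f₃` with the decay `(1 + κ)^(−α)`, `α > 1`, the Poincaré series of `p⁻¹(Γ)` is continuous -/
theorem continuous_kernelSum_K₃_comap_three (p : (K₃ × G₂) →* H) (hp : Continuous p)
    (hker : (p.ker : Set (K₃ × G₂)).Finite) {Γ : Subgroup H} (hΓ : IsolatedOne Γ)
    {f₁ : K₃ → ℂ} {f₂ f₃ : SL(2, ℝ) → ℂ} (hc₁ : Continuous f₁) (hc₂ : Continuous f₂) (hc₃ : Continuous f₃)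
    {C₂ C₃ α : ℝ} (hα : 1 < α) (h₂ : ∀ g, ‖f₂ g‖ ≤ C₂ * (1 + κ g) ^ (-α)) (h₃ : ∀ g, ‖f₃ g‖ ≤ C₃ * (1 + κ g) ^ (-α)) :
    Continuous (fun q : (K₃ × G₂) × (K₃ × G₂) => PoincareKernel.kernelSum (fun γ : Γ.comap p => (γ : K₃ × G₂))
      (fun g : K₃ × G₂ => f₁ g.1 * (f₂ g.2.1 * f₃ g.2.2)) q.1 q.2) := by
  obtain ⟨C₁, h₁⟩ := exists_bound_of_continuous_K₃ hc₁
  exact continuous_kernelSum_K₃_product_three (Γ.comap p) (isolatedOneTop_comap_of_finite_ker p hp hker hΓ)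
    hc₁ hc₂ hc₃ hα h₁ h₂ h₃

end K₃

/-! ## 6. (v2, append-only) Continuity of the REAL kernel when the cover is open: `p × p` is then a quotient map, and the real
kernel is `|ker p|⁻¹` times the lifted kernel composed with `p × p` -/

section OpenCover

variable {K : Type} [TopologicalSpace K] [Group K] [IsTopologicalGroup K] [T2Space K] [CompactSpace K]
  {H : Type} [TopologicalSpace H] [Group H]

/-- **THE REAL KERNEL IS CONTINUOUS** on `H × H` when the cover `p : K × SL(2,ℝ)² →* H` is continuous, OPEN and surjective
with finite kernel, `Γ ≤ H` has `1` isolated and the pull-back `f ∘ p` is continuous with the decay `(1 + psize g.2)^(−α)`,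
`α > 1`: `p × p` is a quotient map (`IsOpenMap.isQuotientMap`), and `K_f ∘ (p × p) = |ker p|⁻¹ · K_{f ∘ p}` (`kernelSum_comap_eq`)
is continuous by `DiscreteCompactFactor.continuous_kernelSum_compact_product` -/
theorem continuous_kernelSum_of_comap [T1Space K] (p : (K × G₂) →* H) (hp : Continuous p) (hopen : IsOpenMap p)
    (hsurj : Function.Surjective p) (hker : (p.ker : Set (K × G₂)).Finite) {Γ : Subgroup H} (hΓ : IsolatedOne Γ)
    (f : H → ℂ) (hfc : Continuous f) {α C : ℝ} (hα : 1 < α) (hf : ∀ g, ‖f (p g)‖ ≤ C * (1 + psize g.2) ^ (-α)) :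
    Continuous (fun q : H × H => PoincareKernel.kernelSum (fun γ : Γ => (γ : H)) f q.1 q.2) := by
  haveI : Finite p.ker := hker.to_subtype
  have hcard : (Nat.card p.ker : ℂ) ≠ 0 := by
    have : 0 < Nat.card p.ker := Nat.card_pos
    exact_mod_cast this.ne'
  have hlift := continuous_kernelSum_compact_product (fun g => f (p g)) (hfc.comp hp) (Γ.comap p)
    (isolatedOneTop_comap_of_finite_ker p hp hker hΓ) hα hf
  have hq : Topology.IsQuotientMap (Prod.map p p) :=
    (hopen.prodMap hopen).isQuotientMap (hp.prodMap hp) (hsurj.prodMap hsurj)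
  rw [hq.continuous_iff]
  have hfun : ((fun q : H × H => PoincareKernel.kernelSum (fun γ : Γ => (γ : H)) f q.1 q.2) ∘ Prod.map p p)
      = fun q : (K × G₂) × (K × G₂) => (Nat.card p.ker : ℂ)⁻¹ *
          PoincareKernel.kernelSum (fun γ : Γ.comap p => (γ : K × G₂)) (fun g => f (p g)) q.1 q.2 := by
    funext q
    simp only [Function.comp, Prod.map]
    rw [kernelSum_comap_eq p hp hsurj hker hΓ f hα hf q.1 q.2, ← mul_assoc, inv_mul_cancel₀ hcard, one_mul]
  rw [hfun]
  exact continuous_const.mul hlift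

end OpenCover

section OpenCoverK₃

variable {H : Type} [TopologicalSpace H] [Group H]

/-- **THE LINE'S REAL ARCHIMEDEAN KERNEL** (in words: `H = U(2) × U(1,1)²`, `p` the product of the 2-to-1 covers with `cay`):
for `Γ ≤ H` with `1` isolated, an open continuous surjective cover `p : (U(2) × U(1)²) × SL(2,ℝ)² →* H` with finite kernel,
and a test function `f` on `H` whose pull-back FACTORS as `f (p g) = f₁ g.1 · f₂ g.2.1 · f₃ g.2.2` with `f₁` continuous on the
compact factor and `f₂, f₃` continuous with the decay `(1 + κ)^(−α)`, `α > 1`, the Poincaré series of `Γ` for `f` is continuous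
on `H × H` -/
theorem continuous_kernelSum_K₃_of_comap_three (p : (K₃ × G₂) →* H) (hp : Continuous p) (hopen : IsOpenMap p)
    (hsurj : Function.Surjective p) (hker : (p.ker : Set (K₃ × G₂)).Finite) {Γ : Subgroup H} (hΓ : IsolatedOne Γ)
    (f : H → ℂ) (hfc : Continuous f) {f₁ : K₃ → ℂ} {f₂ f₃ : SL(2, ℝ) → ℂ} (hc₁ : Continuous f₁)
    (hfp : ∀ g : K₃ × G₂, f (p g) = f₁ g.1 * (f₂ g.2.1 * f₃ g.2.2)) {C₂ C₃ α : ℝ} (hα : 1 < α)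
    (h₂ : ∀ g, ‖f₂ g‖ ≤ C₂ * (1 + κ g) ^ (-α)) (h₃ : ∀ g, ‖f₃ g‖ ≤ C₃ * (1 + κ g) ^ (-α)) :
    Continuous (fun q : H × H => PoincareKernel.kernelSum (fun γ : Γ => (γ : H)) f q.1 q.2) := by
  haveI := compactSpace_K₃
  obtain ⟨C₁, h₁⟩ := exists_bound_of_continuous_K₃ hc₁
  refine continuous_kernelSum_of_comap p hp hopen hsurj hker hΓ f hfc hα (C := C₁ * (C₂ * C₃)) fun g => ?_
  rw [hfp g]
  exact norm_three_le h₁ h₂ h₃ g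

end OpenCoverK₃

end

end Summit.Ventures.HodgeRepro2.Tier7.Line3.DiscreteCoverLift
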